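import Literature.NumberTheory.Sieve.MaynardSieveWeights
import Literature.NumberTheory.Sieve.MaynardSieveBilinear
import HarnessLib

/-!
# Maynard's variables `y^{(m)}` and the exact part of Lemma 5.3 (Maynard 2015 §5)

Topic `Literature/NumberTheory/Sieve`; continues `MaynardSieveWeights.lean` (J. Maynard, *Small gaps
between primes*, Ann. of Math. (2) 181 (2015), 383–413 = arXiv:1311.4600; pages refer to the arXiv
text). For the sum `S₂^{(m)}` Maynard introduces (proof of Lemma 5.2, p. 11) the variables

  `y^{(m)}_{r₁,…,r_k} = (∏ᵢ μ(rᵢ) g(rᵢ)) ∑_{d : rᵢ ∣ dᵢ ∀ i, d_m = 1} λ_d / ∏ᵢ φ(dᵢ)`,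

`g` the totally multiplicative function with `g(p) = p − 2`, and relates them to the `y` of Lemma 5.1
in Lemma 5.3 (p. 11): for `r_m = 1`,
`y^{(m)}_r = ∑_{a_m} y_{r₁,…,r_{m−1},a_m,r_{m+1},…,r_k}/φ(a_m) + O(y_max φ(W) log R/(W D₀))`.
The proof of Lemma 5.3 first derives the EXACT identity (its third display — the second on p. 12)

  `y^{(m)}_r = (∏ᵢ μ(rᵢ) g(rᵢ)) ∑_{a : rᵢ ∣ aᵢ} (y_a/∏ φ(aᵢ)) ∏_{i ≠ m} μ(aᵢ) rᵢ/φ(aᵢ)`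

("We can now evaluate the sum over `d₁,…,d_k` explicitly") and then estimates the terms `a_j ≠ r_j`.
This file defines `g` (`maynardG`) and `y^{(m)}` (`maynardYm`) for `λ = maynardWeight`, proves
`λ_d = (∏ μ(dᵢ)dᵢ) ∑_{a : d ∣ a} y_a/∏ φ(aᵢ)` (`maynardWeight_eq_sum_maynardY`, the inversion of
Lemma 5.1 read forwards, from `maynardY_eq`), and proves the exact identity (`maynardYm_eq_sum`).
Bridges to the finite bilinear-form file `MaynardSieveBilinear.lean` (namespace `Literature.MaynardSieve`,
arbitrary `y` on a box `[1, B]^k`): `maynardWeight_eq_lam` (`maynardWeight k F R W = lam ⌊R⌋₊ y` with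
`y = maynardY k F R W`, the bridge promised in that file's header), `maynardG_eq_gAF_of_squarefree`
(`maynardG`, the literally "totally multiplicative" `g`, agrees with `MaynardSieve.gAF` on squarefree
arguments — the only ones at which `g` is ever evaluated; they differ off squarefrees, e.g. at `25`),
and `maynardYm_eq_ym` (`maynardYm k F R W m = MaynardSieve.ym W ⌊R⌋₊ (maynardY k F R W) m`: the sum
over the whole box in the printed definition equals the sum over good tuples since `λ_d = 0` off good
`d`, `isGood_of_maynardWeight_ne_zero`). So `MaynardSieve.abs_S2main_sub_le` (Lemma 5.2's main term)
and `maynardYm_eq_sum` (Lemma 5.3's exact part) speak about the same `y^{(m)}`.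
Its one-variable core is `∑_{d ∣ n, r ∣ d} μ(d) d/φ(d) = μ(n) r/φ(n)` for squarefree `n`
(`sum_filter_dvd_moebius_mul_div_totient`), from `∑_{e ∣ m} μ(e) e/φ(e) = μ(m)/φ(m)`
(`sum_divisors_moebius_mul_idDivTotient`, Mathlib's `prodPrimeFactors_one_sub_of_squarefree`).
The error estimate of Lemma 5.3 (the terms `a_j ≠ r_j`, `j ≠ m`) is NOT treated here.

## References

* J. Maynard, *Small gaps between primes*, Ann. of Math. (2) 181 (2015), 383–413,
  doi:10.4007/annals.2015.181.1.7, arXiv:1311.4600 [MaynardAnnals2015]: Lemma 5.2 and its proof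
  (the function `g`, the variables `y^{(m)}`, pp. 10–11), Lemma 5.3 and its proof (pp. 11–12).
-/

noncomputable section

open Finset ArithmeticFunction
open scoped BigOperators ArithmeticFunction.Moebius

namespace Literature.NumberTheory.Sieve

/-! ### One-variable identities -/

/-- `d ↦ d/φ(d)` as a real arithmetic function (multiplicative). [folklore] -/
def idDivTotient : ArithmeticFunction ℝ :=
  ⟨fun d => (d : ℝ) / (Nat.totient d : ℝ), by simp⟩

/-- Unfolding `idDivTotient`. [folklore] -/
theorem idDivTotient_apply (d : ℕ) : idDivTotient d = (d : ℝ) / (Nat.totient d : ℝ) := rfl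

/-- `d ↦ d/φ(d)` is multiplicative (`φ(mn) = φ(m)φ(n)` for coprime `m, n`). [folklore] -/
theorem isMultiplicative_idDivTotient : IsMultiplicative idDivTotient := by
  refine ⟨by simp [idDivTotient_apply], fun {m n} hmn => ?_⟩
  simp only [idDivTotient_apply, Nat.cast_mul, Nat.totient_mul hmn]
  rw [mul_div_mul_comm]

/-- `d ↦ μ(d)/φ(d)` as a real arithmetic function (multiplicative). [folklore] -/
def moebiusDivTotient : ArithmeticFunction ℝ :=
  ⟨fun d => ((μ d : ℤ) : ℝ) / (Nat.totient d : ℝ), by simp⟩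

/-- Unfolding `moebiusDivTotient`. [folklore] -/
theorem moebiusDivTotient_apply (d : ℕ) :
    moebiusDivTotient d = ((μ d : ℤ) : ℝ) / (Nat.totient d : ℝ) := rfl

/-- `d ↦ μ(d)/φ(d)` is multiplicative. [folklore] -/
theorem isMultiplicative_moebiusDivTotient : IsMultiplicative moebiusDivTotient := by
  refine ⟨by simp [moebiusDivTotient_apply], fun {m n} hmn => ?_⟩
  simp only [moebiusDivTotient_apply, Nat.totient_mul hmn, Nat.cast_mul,
    isMultiplicative_moebius.map_mul_of_coprime hmn, Int.cast_mul]
  rw [mul_div_mul_comm]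

/-- For squarefree `m`: `∑_{e ∣ m} μ(e) e/φ(e) = ∏_{p ∣ m} (1 − p/(p−1)) = ∏_{p ∣ m} (−1/(p−1)) = μ(m)/φ(m)`. [folklore] -/
theorem sum_divisors_moebius_mul_idDivTotient {m : ℕ} (hm : Squarefree m) :
    ∑ e ∈ m.divisors, ((μ e : ℤ) : ℝ) * ((e : ℝ) / (Nat.totient e : ℝ)) =
      ((μ m : ℤ) : ℝ) / (Nat.totient m : ℝ) := by
  have h1 := isMultiplicative_idDivTotient.prodPrimeFactors_one_sub_of_squarefree idDivTotient hm
  simp only [idDivTotient_apply] at h1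
  rw [← h1]
  have h2 := isMultiplicative_moebiusDivTotient.map_prod_of_subset_primeFactors m m.primeFactors
    Finset.Subset.rfl
  rw [Nat.prod_primeFactors_of_squarefree hm] at h2
  simp only [moebiusDivTotient_apply] at h2
  rw [h2]
  refine Finset.prod_congr rfl fun p hp => ?_
  have hp' := (Nat.mem_primeFactors.mp hp).1
  rw [ArithmeticFunction.moebius_apply_prime hp', Nat.totient_prime hp']
  have h2le : 2 ≤ p := hp'.two_le
  have hcast : ((p - 1 : ℕ) : ℝ) = (p : ℝ) - 1 := by
    rw [Nat.cast_sub (by omega)]; simp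
  rw [hcast]
  have hne : (p : ℝ) - 1 ≠ 0 := by
    have : (2 : ℝ) ≤ p := by exact_mod_cast h2le
    linarith
  field_simp
  push_cast
  ring

/-- For squarefree `n` and `r ∣ n`: `∑_{d ∣ n, r ∣ d} μ(d) d/φ(d) = μ(n) r/φ(n)` — the evaluation,
coordinate by coordinate, of the `d`-sum in Maynard's proof of Lemma 5.3 ("We can now evaluate the
sum over `d₁,…,d_k` explicitly", p. 12). [cite: MaynardAnnals2015, proof of Lemma 5.3] -/
theorem sum_filter_dvd_moebius_mul_div_totient {n r : ℕ} (hn : Squarefree n) (hr : r ∣ n) :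
    ∑ d ∈ n.divisors.filter (fun d => r ∣ d), ((μ d : ℤ) : ℝ) * ((d : ℝ) / (Nat.totient d : ℝ)) =
      ((μ n : ℤ) : ℝ) * (r : ℝ) / (Nat.totient n : ℝ) := by
  have hn0 : n ≠ 0 := hn.ne_zero
  obtain ⟨m, rfl⟩ := hr
  have hr0 : r ≠ 0 := left_ne_zero_of_mul hn0
  have hm0 : m ≠ 0 := right_ne_zero_of_mul hn0
  have hcop : r.Coprime m := Nat.coprime_of_squarefree_mul hn
  have hset : (r * m).divisors.filter (fun d => r ∣ d) = m.divisors.image (fun e => r * e) := by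
    ext d
    simp only [Finset.mem_filter, Nat.mem_divisors, Finset.mem_image]
    constructor
    · rintro ⟨⟨hd, -⟩, ⟨e, rfl⟩⟩
      exact ⟨e, ⟨(Nat.mul_dvd_mul_iff_left (Nat.pos_of_ne_zero hr0)).mp hd, hm0⟩, rfl⟩
    · rintro ⟨e, ⟨he, -⟩, rfl⟩
      exact ⟨⟨Nat.mul_dvd_mul_left r he, mul_ne_zero hr0 hm0⟩, Dvd.intro e rfl⟩
  rw [hset, Finset.sum_image
    (fun e₁ _ e₂ _ h => Nat.eq_of_mul_eq_mul_left (Nat.pos_of_ne_zero hr0) h)]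
  have hterm : ∀ e ∈ m.divisors, ((μ (r * e) : ℤ) : ℝ) * (((r * e : ℕ) : ℝ) / (Nat.totient (r * e) : ℝ)) =
      (((μ r : ℤ) : ℝ) * ((r : ℝ) / (Nat.totient r : ℝ))) *
        (((μ e : ℤ) : ℝ) * ((e : ℝ) / (Nat.totient e : ℝ))) := by
    intro e he
    have hre : r.Coprime e := hcop.coprime_dvd_right (Nat.dvd_of_mem_divisors he)
    rw [isMultiplicative_moebius.map_mul_of_coprime hre, Nat.totient_mul hre]
    push_cast
    ring
  rw [Finset.sum_congr rfl hterm, ← Finset.mul_sum,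
    sum_divisors_moebius_mul_idDivTotient (hn.squarefree_of_dvd (Dvd.intro_left r rfl)),
    isMultiplicative_moebius.map_mul_of_coprime hcop, Nat.totient_mul hcop]
  push_cast
  ring


/-! ### `g`, `y^{(m)}` and the exact part of Lemma 5.3 -/

/-- Maynard's `g`: "the totally multiplicative function defined on primes by `g(p) = p − 2`"
(Maynard 2015, Lemma 5.2), real-valued: `g(n) = ∏_{p^a ∥ n} (p − 2)^a` (`g(0) = 1`, junk value).
[cite: MaynardAnnals2015, Lemma 5.2] -/
def maynardG (n : ℕ) : ℝ := n.factorization.prod fun p a => ((p : ℝ) - 2) ^ a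

/-- `g(1) = 1`. [folklore] -/
theorem maynardG_one : maynardG 1 = 1 := by simp [maynardG]

/-- `g` is totally multiplicative: `g(mn) = g(m) g(n)` for `m, n ≠ 0`. [cite: MaynardAnnals2015, Lemma 5.2] -/
theorem maynardG_mul {m n : ℕ} (hm : m ≠ 0) (hn : n ≠ 0) :
    maynardG (m * n) = maynardG m * maynardG n := by
  unfold maynardG
  rw [Nat.factorization_mul hm hn, Finsupp.prod_add_index']
  · intro p; simp
  · intro p a b; exact pow_add _ _ _

/-- `g(p) = p − 2`. [cite: MaynardAnnals2015, Lemma 5.2] -/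
theorem maynardG_prime {p : ℕ} (hp : p.Prime) : maynardG p = p - 2 := by
  unfold maynardG
  rw [hp.factorization, Finsupp.prod_single_index] <;> simp

/-- On squarefree `n`, `g(n) = ∏_{p ∣ n} (p − 2)`. [cite: MaynardAnnals2015, Lemma 5.2] -/
theorem maynardG_of_squarefree {n : ℕ} (hn : Squarefree n) :
    maynardG n = ∏ p ∈ n.primeFactors, ((p : ℝ) - 2) := by
  unfold maynardG
  rw [Finsupp.prod, Nat.support_factorization]
  refine Finset.prod_congr rfl fun p hp => ?_
  rw [Nat.factorization_eq_one_of_squarefree hn (Nat.mem_primeFactors.mp hp).1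
    (Nat.mem_primeFactors.mp hp).2.1, pow_one]


/-- `maynardG` agrees with `MaynardSieve.gAF` (`n ↦ ∏_{p ∣ n} (p − 2)`, `MaynardSieveBilinear.lean`)
on squarefree `n` — the only arguments at which Maynard's `g` is evaluated (the `μ(rᵢ)` in `y^{(m)}`
kill the rest); off squarefrees they differ (`maynardG 25 = 9`, `gAF 25 = 3`). [folklore] -/
theorem maynardG_eq_gAF_of_squarefree {n : ℕ} (hn : Squarefree n) :
    maynardG n = MaynardSieve.gAF n := by
  rw [maynardG_of_squarefree hn, MaynardSieve.gAF_apply hn.ne_zero]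

/-- Maynard's variables `y^{(m)}_{r₁,…,r_k} = (∏ᵢ μ(rᵢ) g(rᵢ)) ∑_{d : rᵢ ∣ dᵢ ∀ i, d_m = 1} λ_d / ∏ᵢ φ(dᵢ)`
(proof of Lemma 5.2, p. 11: "We let …"), for `λ_d = maynardWeight k F R W d`, the `dᵢ` running over
the box `1 ≤ dᵢ ≤ ⌊R⌋` (outside which `λ_d = 0`). [cite: MaynardAnnals2015, proof of Lemma 5.2 (definition of y^(m), p. 11)] -/
def maynardYm (k : ℕ) (F : (Fin k → ℝ) → ℝ) (R : ℝ) (W : ℕ) (m : Fin k) (r : Fin k → ℕ) : ℝ :=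
  (∏ i, ((μ (r i) : ℤ) : ℝ) * maynardG (r i)) *
    ∑ d ∈ (maynardBox k R).filter (fun d => (∀ i, r i ∣ d i) ∧ d m = 1),
      maynardWeight k F R W d / ∏ i, (Nat.totient (d i) : ℝ)


/-- "We note `y^{(m)}_{r₁,…,r_k} = 0` unless `r_m = 1`" (Maynard 2015, proof of Lemma 5.2, p. 11):
the conditions `r_m ∣ d_m` and `d_m = 1` force `r_m = 1`. [cite: MaynardAnnals2015, proof of Lemma 5.2] -/
theorem maynardYm_eq_zero_of_ne_one {k : ℕ} (F : (Fin k → ℝ) → ℝ) (R : ℝ) (W : ℕ) (m : Fin k)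
    {r : Fin k → ℕ} (hrm : r m ≠ 1) : maynardYm k F R W m r = 0 := by
  unfold maynardYm
  have hempty : (maynardBox k R).filter (fun d => (∀ i, r i ∣ d i) ∧ d m = 1) = ∅ := by
    ext d
    simp only [Finset.mem_filter, Finset.notMem_empty, iff_false, not_and]
    intro _ hdiv hdm
    exact hrm (Nat.dvd_one.mp (hdm ▸ hdiv m))
  rw [hempty, Finset.sum_empty, mul_zero]

/-- `λ_d = (∏ μ(dᵢ) dᵢ) ∑_{a in the box : dᵢ ∣ aᵢ} y_a / ∏ φ(aᵢ)` (Maynard 2015, proof of Lemma 5.1: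
"Thus any choice of `y_{r₁,…,r_k}` supported on … will give a suitable choice of `λ_{d₁,…,d_k}`", and
the formula (5.10) substituted into the proof of Lemma 5.3), obtained by reading `maynardY_eq`
back into the definition of `maynardWeight`. [cite: MaynardAnnals2015, proofs of Lemmas 5.1 and 5.3] -/
theorem maynardWeight_eq_sum_maynardY {k : ℕ} (F : (Fin k → ℝ) → ℝ) (R : ℝ) (W : ℕ)
    (d : Fin k → ℕ) :
    maynardWeight k F R W d =
      (∏ i, ((μ (d i) : ℤ) : ℝ) * (d i : ℝ)) *
        ∑ a ∈ (maynardBox k R).filter (fun a => ∀ i, d i ∣ a i),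
          maynardY k F R W a / ∏ i, (Nat.totient (a i) : ℝ) := by
  rw [maynardWeight]
  congr 1
  symm
  calc ∑ a ∈ (maynardBox k R).filter (fun a => ∀ i, d i ∣ a i),
          maynardY k F R W a / ∏ i, (Nat.totient (a i) : ℝ)
      = ∑ a ∈ (maynardBox k R).filter (fun a => ∀ i, d i ∣ a i),
          (if (∀ i, Nat.Coprime (a i) W) then
            ((μ (∏ i, a i) : ℤ) : ℝ) ^ 2 / (∏ i, (Nat.totient (a i) : ℝ)) *
              (maynardSimplex k).indicator F (fun i => Real.log (a i) / Real.log R) else 0) := by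
        refine Finset.sum_congr rfl fun a ha => ?_
        rw [maynardY_eq F R W (Finset.mem_filter.mp ha).1]
        split_ifs
        · ring
        · simp
    _ = ∑ a ∈ ((maynardBox k R).filter (fun a => ∀ i, d i ∣ a i)).filter
          (fun a => ∀ i, Nat.Coprime (a i) W),
          ((μ (∏ i, a i) : ℤ) : ℝ) ^ 2 / (∏ i, (Nat.totient (a i) : ℝ)) *
            (maynardSimplex k).indicator F (fun i => Real.log (a i) / Real.log R) :=
        (Finset.sum_filter _ _).symm
    _ = _ := by
        refine Finset.sum_congr ?_ fun a _ => rfl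
        rw [Finset.filter_filter]
        refine Finset.filter_congr fun a _ => ?_
        exact ⟨fun h i => ⟨h.1 i, h.2 i⟩, fun h => ⟨fun i => (h i).1, fun i => (h i).2⟩⟩

/-- **Bridge to `MaynardSieveBilinear.lean`**: the weights of Prop. 4.1 are `lam ⌊R⌋₊ y` for
`y = maynardY k F R W` ("the weights of Prop. 4.1, `Literature.maynardWeight k F R W`, are `lam ⌊R⌋₊ y_F`",
header of that file; `maynardBox k R` is `MaynardSieve.box k ⌊R⌋₊` by definition).
[cite: MaynardAnnals2015, Prop. 4.1 and (5.10)] -/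
theorem maynardWeight_eq_lam {k : ℕ} (F : (Fin k → ℝ) → ℝ) (R : ℝ) (W : ℕ) (d : Fin k → ℕ) :
    maynardWeight k F R W d = MaynardSieve.lam ⌊R⌋₊ (maynardY k F R W) d := by
  rw [MaynardSieve.lam_def]
  exact maynardWeight_eq_sum_maynardY F R W d

/-- `λ_d ≠ 0` only for good `d` (product squarefree and coprime to `W`): Maynard's restriction of
the support of `λ` (§5, first paragraph), automatic for `maynardWeight`. [cite: MaynardAnnals2015, §5, first paragraph] -/
theorem isGood_of_maynardWeight_ne_zero {k : ℕ} (F : (Fin k → ℝ) → ℝ) (R : ℝ) (W : ℕ)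
    {d : Fin k → ℕ} (hd : maynardWeight k F R W d ≠ 0) : MaynardSieve.IsGood W d := by
  rw [maynardWeight_eq_sum_maynardY] at hd
  have hsum : ∑ a ∈ (maynardBox k R).filter (fun a => ∀ i, d i ∣ a i),
      maynardY k F R W a / ∏ i, (Nat.totient (a i) : ℝ) ≠ 0 := fun h => hd (by rw [h, mul_zero])
  obtain ⟨a, ha, hane⟩ := Finset.exists_ne_zero_of_sum_ne_zero hsum
  obtain ⟨habox, hda⟩ := Finset.mem_filter.mp ha
  have hya : maynardY k F R W a ≠ 0 := fun h => hane (by rw [h, zero_div])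
  rw [maynardY_eq F R W habox] at hya
  have hcop : ∀ i, Nat.Coprime (a i) W := by
    by_contra h
    exact hya (if_neg h)
  rw [if_pos hcop] at hya
  have hsq : Squarefree (∏ i, a i) := by
    by_contra h
    apply hya
    rw [ArithmeticFunction.moebius_eq_zero_of_not_squarefree h]
    simp
  have hgood : MaynardSieve.IsGood W a :=
    ⟨hsq, Nat.Coprime.prod_left fun i _ => hcop i⟩
  exact hgood.of_dvd hda

/-- **Bridge to `MaynardSieveBilinear.lean`**: `maynardYm k F R W m = MaynardSieve.ym W ⌊R⌋₊ y m` for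
`y = maynardY k F R W`. The printed definition sums over all `d` of the box with `rᵢ ∣ dᵢ`,
`d_m = 1`; `MaynardSieve.ym` sums `λ_d [d_m = 1]` over the good tuples only — the same thing, since
`λ_d = 0` off good `d` (`isGood_of_maynardWeight_ne_zero`), and the prefactors `∏ μ(rᵢ) g(rᵢ)`
agree because `μ(rᵢ) = 0` unless `rᵢ` is squarefree (`maynardG_eq_gAF_of_squarefree`).
[cite: MaynardAnnals2015, proof of Lemma 5.2 (definition of y^(m), p. 11)] -/
theorem maynardYm_eq_ym {k : ℕ} (F : (Fin k → ℝ) → ℝ) (R : ℝ) (W : ℕ) (m : Fin k)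
    (r : Fin k → ℕ) :
    maynardYm k F R W m r = MaynardSieve.ym W ⌊R⌋₊ (maynardY k F R W) m r := by
  rw [MaynardSieve.ym_def, maynardYm]
  congr 1
  · refine Finset.prod_congr rfl fun i _ => ?_
    by_cases hsq : Squarefree (r i)
    · rw [maynardG_eq_gAF_of_squarefree hsq]
    · rw [ArithmeticFunction.moebius_eq_zero_of_not_squarefree hsq]
      simp
  · -- both sides are the sum of `λ_d / ∏ φ(dᵢ)` over `{d ∈ box : good, r ∣ d, d_m = 1}`
    have hL : ∑ d ∈ (maynardBox k R).filter (fun d => (∀ i, r i ∣ d i) ∧ d m = 1),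
        maynardWeight k F R W d / ∏ i, (Nat.totient (d i) : ℝ) =
        ∑ d ∈ ((maynardBox k R).filter (fun d => (∀ i, r i ∣ d i) ∧ d m = 1)).filter
          (MaynardSieve.IsGood W),
          maynardWeight k F R W d / ∏ i, (Nat.totient (d i) : ℝ) := by
      refine (Finset.sum_filter_of_ne fun d _ hne => ?_).symm
      exact isGood_of_maynardWeight_ne_zero F R W fun h => hne (by rw [h, zero_div])
    have hR : ∑ d ∈ (MaynardSieve.boxG k W ⌊R⌋₊).filter (fun d => ∀ i, r i ∣ d i),
        MaynardSieve.lamM ⌊R⌋₊ (maynardY k F R W) m d / ∏ i, MaynardSieve.totAF (d i) =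
        ∑ d ∈ ((MaynardSieve.boxG k W ⌊R⌋₊).filter (fun d => ∀ i, r i ∣ d i)).filter
          (fun d => d m = 1),
          maynardWeight k F R W d / ∏ i, (Nat.totient (d i) : ℝ) := by
      conv_rhs => rw [Finset.sum_filter]
      refine Finset.sum_congr rfl fun d _ => ?_
      rw [MaynardSieve.lamM_def]
      split_ifs with hdm
      · rw [← maynardWeight_eq_lam]
        rfl
      · rw [zero_div]
    rw [hL, hR]
    refine Finset.sum_congr ?_ fun d _ => rfl
    ext d
    simp only [Finset.mem_filter, MaynardSieve.mem_boxG]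
    constructor
    · rintro ⟨⟨hb, hrd, hdm⟩, hg⟩
      exact ⟨⟨⟨hb, hg⟩, hrd⟩, hdm⟩
    · rintro ⟨⟨⟨hb, hg⟩, hrd⟩, hdm⟩
      exact ⟨⟨hb, hrd, hdm⟩, hg⟩

/-- The coordinate ranges of the `d`-sum in the proof of Lemma 5.3: `{1}` at `m`, and the divisors
of `aᵢ` that are multiples of `rᵢ` elsewhere. [cite: MaynardAnnals2015, proof of Lemma 5.3] -/
def lemma53CoordRange {k : ℕ} (m : Fin k) (r a : Fin k → ℕ) (i : Fin k) : Finset ℕ :=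
  if i = m then {1} else (a i).divisors.filter (fun x => r i ∣ x)

/-- The `d`-sum of the proof of Lemma 5.3 runs over the product of the coordinate ranges (given
`r_m = 1` and `a` in the box), so that it factorises. [cite: MaynardAnnals2015, proof of Lemma 5.3] -/
theorem filter_box_eq_piFinset_lemma53CoordRange {k : ℕ} {R : ℝ} (m : Fin k) (r a : Fin k → ℕ)
    (hrm : r m = 1) (ha : a ∈ maynardBox k R) :
    (maynardBox k R).filter (fun d => ((∀ i, r i ∣ d i) ∧ d m = 1) ∧ ∀ i, d i ∣ a i) =
      Fintype.piFinset (lemma53CoordRange m r a) := by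
  have ha' := mem_maynardBox_iff.mp ha
  ext d
  simp only [Finset.mem_filter, mem_maynardBox_iff, Fintype.mem_piFinset, lemma53CoordRange]
  constructor
  · rintro ⟨hd, ⟨hrd, hdm⟩, hda⟩ i
    by_cases him : i = m
    · subst him; simp [hdm]
    · rw [if_neg him, Finset.mem_filter, Nat.mem_divisors]
      exact ⟨⟨hda i, by have := (ha' i).1; omega⟩, hrd i⟩
  · intro h
    have hcoord : ∀ i, i ≠ m → d i ∣ a i ∧ d i ≠ 0 ∧ r i ∣ d i := by
      intro i him
      have hi := h i
      rw [if_neg him, Finset.mem_filter, Nat.mem_divisors] at hi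
      exact ⟨hi.1.1, fun h0 => by
        have := hi.1.1; rw [h0, zero_dvd_iff] at this; exact absurd this (by have := (ha' i).1; omega),
        hi.2⟩
    have hdm : d m = 1 := by have := h m; simpa using this
    refine ⟨fun i => ?_, ⟨fun i => ?_, hdm⟩, fun i => ?_⟩
    · by_cases him : i = m
      · subst him; rw [hdm]; exact ⟨le_rfl, (ha' i).1.trans (ha' i).2⟩
      · obtain ⟨h1, h2, -⟩ := hcoord i him
        exact ⟨Nat.pos_of_ne_zero h2, (Nat.le_of_dvd (ha' i).1 h1).trans (ha' i).2⟩
    · by_cases him : i = m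
      · subst him; rw [hdm, hrm]
      · exact (hcoord i him).2.2
    · by_cases him : i = m
      · subst him; rw [hdm]; exact one_dvd _
      · exact (hcoord i him).1

/-- **The exact part of Maynard's Lemma 5.3** (proof of Lemma 5.3, its third display = the second
display on p. 12; obtained from the first two by substituting `λ` in terms of `y`, swapping the
`d`- and `a`-sums, and evaluating the `d`-sum):
for `r_m = 1`,
`y^{(m)}_r = (∏ᵢ μ(rᵢ) g(rᵢ)) ∑_{a : rᵢ ∣ aᵢ ∀ i} (y_a / ∏ φ(aᵢ)) ∏_{i ≠ m} μ(aᵢ) rᵢ / φ(aᵢ)`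
(terms with `∏ aᵢ` not squarefree vanish on both sides since then `y_a = 0`).
[cite: MaynardAnnals2015, proof of Lemma 5.3] -/
theorem maynardYm_eq_sum {k : ℕ} (F : (Fin k → ℝ) → ℝ) (R : ℝ) (W : ℕ) (m : Fin k)
    {r : Fin k → ℕ} (hrm : r m = 1) :
    maynardYm k F R W m r =
      (∏ i, ((μ (r i) : ℤ) : ℝ) * maynardG (r i)) *
        ∑ a ∈ (maynardBox k R).filter (fun a => ∀ i, r i ∣ a i),
          (maynardY k F R W a / ∏ i, (Nat.totient (a i) : ℝ)) *
            ∏ i ∈ Finset.univ.erase m, ((μ (a i) : ℤ) : ℝ) * (r i : ℝ) / (Nat.totient (a i) : ℝ) := by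
  unfold maynardYm
  congr 1
  set Box := maynardBox k R with hBox
  -- Step 1: insert λ_d in terms of y, and normalise λ_d / ∏ φ(dᵢ)
  have hstep1 : ∀ d ∈ Box.filter (fun d => (∀ i, r i ∣ d i) ∧ d m = 1),
      maynardWeight k F R W d / ∏ i, (Nat.totient (d i) : ℝ) =
        ∑ a ∈ Box.filter (fun a => ∀ i, d i ∣ a i),
          (∏ i, ((μ (d i) : ℤ) : ℝ) * (d i : ℝ) / (Nat.totient (d i) : ℝ)) *
            (maynardY k F R W a / ∏ i, (Nat.totient (a i) : ℝ)) := by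
    intro d _
    rw [maynardWeight_eq_sum_maynardY F R W d]
    have hpd : (∏ i, ((μ (d i) : ℤ) : ℝ) * (d i : ℝ) / (Nat.totient (d i) : ℝ)) =
        (∏ i, ((μ (d i) : ℤ) : ℝ) * (d i : ℝ)) / ∏ i, (Nat.totient (d i) : ℝ) :=
      Finset.prod_div_distrib _ _
    rw [hpd, Finset.mul_sum, Finset.sum_div]
    refine Finset.sum_congr rfl fun a _ => ?_
    ring
  rw [Finset.sum_congr rfl hstep1]
  -- abbreviations
  set c : (Fin k → ℕ) → ℝ := fun d => ∏ i, ((μ (d i) : ℤ) : ℝ) * (d i : ℝ) / (Nat.totient (d i) : ℝ)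
    with hc
  set Y : (Fin k → ℕ) → ℝ := fun a => maynardY k F R W a / ∏ i, (Nat.totient (a i) : ℝ) with hY
  set P : (Fin k → ℕ) → Prop := fun d => (∀ i, r i ∣ d i) ∧ d m = 1 with hP
  set g : (Fin k → ℕ) → (Fin k → ℕ) → ℝ := fun d a =>
    if P d ∧ (∀ i, d i ∣ a i) then c d * Y a else 0 with hg
  -- Step 2: both sides as the double sum of `g`
  have hL : ∑ d ∈ Box.filter P, ∑ a ∈ Box.filter (fun a => ∀ i, d i ∣ a i), c d * Y a =
      ∑ d ∈ Box, ∑ a ∈ Box, g d a := by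
    rw [Finset.sum_filter]
    refine Finset.sum_congr rfl fun d _ => ?_
    by_cases hd : P d
    · rw [if_pos hd, Finset.sum_filter]
      refine Finset.sum_congr rfl fun a _ => ?_
      by_cases hda : ∀ i, d i ∣ a i
      · simp [hg, hd, hda]
      · simp [hg, hda]
    · rw [if_neg hd]
      refine (Finset.sum_eq_zero fun a _ => ?_).symm
      simp [hg, hd]
  have hU : ∀ a ∈ Box, ∑ d ∈ Box, g d a =
      Y a * ∑ d ∈ Box.filter (fun d => P d ∧ ∀ i, d i ∣ a i), c d := by
    intro a _
    rw [Finset.mul_sum, Finset.sum_filter]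
    refine Finset.sum_congr rfl fun d _ => ?_
    by_cases h : P d ∧ ∀ i, d i ∣ a i
    · simp [hg, h, mul_comm]
    · simp [hg, h]
  rw [hL, Finset.sum_comm, Finset.sum_congr rfl hU, Finset.sum_filter]
  refine Finset.sum_congr rfl fun a ha => ?_
  -- Step 3: the inner sum over `d` for fixed `a`
  by_cases hra : ∀ i, r i ∣ a i
  · rw [if_pos hra]
    have hset := filter_box_eq_piFinset_lemma53CoordRange m r a hrm ha
    simp only [hP] at hset ⊢
    rw [hset]
    simp only [hc]
    have hfac : ∏ i, ∑ y ∈ lemma53CoordRange m r a i, ((μ y : ℤ) : ℝ) * (y : ℝ) / (Nat.totient y : ℝ) =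
        ∑ d ∈ Fintype.piFinset (lemma53CoordRange m r a),
          ∏ i, ((μ (d i) : ℤ) : ℝ) * (d i : ℝ) / (Nat.totient (d i) : ℝ) :=
      Finset.prod_univ_sum _ _
    rw [← hfac]
    -- now `Y a * ∏ i, ∑ x ∈ lemma53CoordRange m r a i, μ x * x / φ x`
    by_cases hsq : Squarefree (∏ i, a i)
    · have hsqi : ∀ i, Squarefree (a i) := fun i =>
        hsq.squarefree_of_dvd (Finset.dvd_prod_of_mem _ (Finset.mem_univ i))
      congr 1
      rw [← Finset.mul_prod_erase Finset.univ _ (Finset.mem_univ m)]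
      have hm1 : ∑ x ∈ lemma53CoordRange m r a m, ((μ x : ℤ) : ℝ) * (x : ℝ) / (Nat.totient x : ℝ) = 1 := by
        simp [lemma53CoordRange]
      rw [hm1, one_mul]
      refine Finset.prod_congr rfl fun i hi => ?_
      have him : i ≠ m := Finset.ne_of_mem_erase hi
      simp only [lemma53CoordRange, if_neg him]
      have h53 := sum_filter_dvd_moebius_mul_div_totient (hsqi i) (hra i)
      simp_rw [mul_div_assoc]
      rw [h53, mul_div_assoc]
    · -- `y_a = 0`
      have hYa : Y a = 0 := by
        simp only [hY, maynardY_eq F R W ha, ArithmeticFunction.moebius_eq_zero_of_not_squarefree hsq]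
        simp
      have hYa' : maynardY k F R W a / ∏ i, (Nat.totient (a i) : ℝ) = 0 := hYa
      rw [hYa, hYa', zero_mul, zero_mul]
  · rw [if_neg hra]
    have hempty : Box.filter (fun d => P d ∧ ∀ i, d i ∣ a i) = ∅ := by
      ext d
      simp only [Finset.mem_filter, Finset.notMem_empty, iff_false, not_and, hP]
      intro _ hPd hda
      exact hra fun i => (hPd.1 i).trans (hda i)
    rw [hempty, Finset.sum_empty, mul_zero]

end Literature.NumberTheory.Sieve
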